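import HarnessLib.Audit.LibrarySuggestionsDenyListCorCM
import Summits.HodgeConjecture.HodgeConjecture.Cruxes.HLiu418.Lines.D6CmCurveBody
import Summits.HodgeConjecture.HodgeConjecture.Theorems.HCCMUnconditionalHLiu418OfH415
import Summits.HodgeConjecture.HodgeConjecture.Theorems.F0D9opRoad2   -- ED. v1∕v2 («M-152»): ★ p853642 `F0D9opRoad2.stub_D9op_holds : CorD9OnMOp CMgsm XMgsm` (sorry-free, axioms TRIO) pays `stub_D9op` by term
import Summits.HodgeConjecture.CorCM.HypLiu418.A3Liu418GSRosH
import Literature.AlgebraicGeometry.Motives.JacobianGaloisCoverNormAdjointHolds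
import Literature.AlgebraicGeometry.Motives.JacobianRiemannThetaDivisorHolds
import Summits.HodgeConjecture.HodgeConjecture.Theorems.HCCMUnconditionalHLiu418OfCurveTheta   -- ED. v3 («★-ONLY CONE»): ★ p853732 `HLiu418OfCurveTheta` — the theta rows, [Thm. D.6 (1)], [Thm. 4.15] at the face and the crux decl FROM the letter #184♮, over ★ F1 p853696 `F0P6LD1StubS1FactsOfA2P` · ★ F2 p853699 `F0P6LD2StubS1bFactsOfA2P` · ★ F3 p853706 `F0AlbCmThetaRowsOfFacts` · ★ F4 p853722 `A3Liu418Thm415AtFaceOfThmD6` (LA2-p03 (g9) ∕ LA2-p02 (g7)); replaces v2's imports of `Lines/a3_liu418` + the two LD `Lines` leaves + nine ★ glue modules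

/-! ## LINE TAIL — `Cruxes/HLiu418/Lines/d6_cm_curve` (second line on crux item stmt-HodgeConjecture-24832; HOME DRAFT vB⁗ = VARIANT B⁗ (A-plan2 (g12) d6 pen
03:50:18Z + 03:53:02Z letters, road (P) σ-FREE RE-DRAWN on the Hecke image; A-p11 (g12) 04:33:40Z: the (MO) input is a THEOREM `multOneShapePH_holds` over
★ (F3) A-p07 (g12) `exists_block_multOne`, so `stub_MultOne` is STRUCK — director s214 (3): fewer stubs than B‴ needs no new word): THREE registered stubs {`stub_S1`, `stub_S1b`,
`stub_D9op`} (vB6, director s223 (2): the fourth, `stub_RosH : RosHShape`, is REPLACED by the theorem `rosH_holds` BY IMPORT of ★ p765203 — vB8: BOTH §8.2 Jacobian rows, VI-7 `riemann_brillNoetherLocus_isPrincipalPolarizationDivisor` and VI-8 `galoisCover_pullback_isWeilPairingAdjoint_norm`, are DISCHARGED by import of their ★ closers `…_holds` (roads G5/G4, pen A-p04 (g18)); NO printed-fact binder remains in this file); S2′ input (i) `IrrOrZeroOmegaStarShape` IS A THEOREM — `irrOrZeroOmegaStarShape_holds` (A-p11 (g12) v11 Part M, one line over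
`isIrreducibleOrZero_omegaStarGS` = BARE CorCM ★ p759294 (A-p13 (g19)), BY IMPORT — its olean serves since ≈04:25Z); (MO) input `MultOneShapePH` IS A THEOREM —
`multOneShapePH_holds` (A-p11 (g12) v12 Part O over ★ (F3) `OmegaHomBlockMultOne.exists_block_multOne`, A-p07 (g12) with A-p05 (g12)); `S2primeShape` by A-p11 (g12) v12
`s2primeShape_of_RosH_S1` ∕ `s2primeShape_of_stubShapesM1H` (`stub_S1` consumed a second time as the multiplicity-one input).  Spliced above, import-free and
BUDGET-FREE: `S2primeRegisteredSockets.v12c-byimport-of-treepair.A-p11g12.lean` 730c84eb3320e3ca S2′ body l.1373–2057 ((VI′)/(VIII′)/(B′)/(O-III)/(C)/(F3) AND the generic S2′ pair ★ p762584/p762846 `CorCM/HypLiu418/S2primeSockets`+`S2primeAssembly` BY IMPORT — no paste at all;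
A-p06 (g15) (O-B′) cure folded, zero `maxHeartbeats` lines), after the composition of record A-p15 (g11) v23 7c34f2c6f9ba73d2 BYTE-VERBATIM (l. 29–2321; REF1 m27 PASS) which
REPLACES v12c՚s v3-era body l.61–1372; A-plan1 (g14) registry pen, 2026-08-30;
card of record `A-plan/d6/D6-LINE-CARD.A-plan2g12.md`; NOT WRITTEN TO THE TREE under s209 — registration = `ledger crux write stmt-HodgeConjecture-24832 Lines/d6_cm_curve.lean` +
`ledger skeleton check … --crux stmt-HodgeConjecture-24832` next run, the generic S2′ letters/assembly being the ★ Summits-side pair `CorCM/HypLiu418/S2primeSockets`+`S2primeAssembly` (s216a (P-a), A-p11 (g12) p762584/p762846) imported here;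
the GS instantiation `CorCM/HypLiu418/A3Liu418GSS2primeOfSockets.lean` stays next run (director s214 (2)); budget-free as of v11b/v12b/v12c.  The SOCKET to the crux decl is
reached BY IMPORT of the registry `Lines/a3_liu418` v22 9cbc89778f0fbf43 + ★ `HLiu418_of_h415` — probe `A-plan/d6/D6SocketByImport.probe.A-plan1g14.lean` ba4a8541d9a93793
(rc 0 ∕ [] ∕ [] ∕ 0, axioms trio).
**EDITION v2 «ONE PRINTED LETTER» (P6 LEAD F0P6-plan (g7) «M-152» 2026-09-03T05:46Z + «M-152b» 05:54:56Z; cand LA1-p02 (g10) from probe «184» e3e72ecf36bd36ac,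
box F0P6-ref1 (g7) + F0P6-lit1 (g11), registrar caution A-plan2 (g31) m20 (ASCII stub name), writer «L3» LA3-plan (g7); previous edition 1b2dd2d3c8885938 registered
{`stub_S1` :41, `stub_S1b` :51, `stub_D9op` :94}).**  The THREE registered stubs of the previous edition are now PAID BY TERM — registered NAMES and STATEMENT TOKENS
UNCHANGED: `stub_D9op := ★ …F0D9opRoad2.stub_D9op_holds` (K6, p853642; MOD boundary CLOSED-DERIVED IN-HOUSE; junction `rfl` in-file); `stub_S1 := s1Shape_of_letter ‹letter›` and
`stub_S1b := s1bShape_of_letter ‹letter›` over the two LD leaves `Lines/F0_P6LD_StubS1FactsThetaRoad.lean` ∕ `Lines/F0_P6LD_StubS1bFactsOrganRoad.lean` (ED. 11: their heads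
`stub_S1_facts_of_organs` ∕ `curveThetaHodgeTypeNecessity_hol_pos_of_organs` and sorry-free organ terms; their own letter stubs are NOT used) and the ★ socket-side heads
(`F0AlbCmS1BettiHoldsSignedThetaNecPos`, `F0AlbCmS1bHodgeHoldsNecPos`, `F0P5TP2Holds`, `HLiu418E2LevelFinite`, `F0AlbCmStubS1Pinning`, `F0P5StubS1bTransfer`; junction J0 = the
`F0_AlbCm` proof of `s1Shape_of_betti`, re-proved here — `F0_AlbCm` itself is NOT imported, so no second public head on the crux decl enters the environment).  The ONE `sorry`
of the file is the ONE PRINTED LETTER #184♮ `stub_letter_A2P_hodgeFree : Liu2021.curveTheta_nonOrthogonal₂` ([Liu2021, Thm. B.4 (1)]; ASCII name for the gate's skeleton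
reader, same statement as the LD leaves' `stub_letter_A₂P_hodgeFree`).  CERTIFICATE (private, `#h21_check_skeleton` discipline): `HLiu418_of_letter (h184) (h21) (h413) :
…HCCMUnconditional.HLiu418` is kernel-checked with axioms {propext, Classical.choice, Quot.sound} — the crux decl from that ONE printed letter + the route items `H21`, `H413`.
Registry act (director ORDER → registrar): 24832 {3} → {1} = {`stub_letter_A2P_hodgeFree`}.  (v2 caveat — the imported LD leaves' census-visible letter `sorry` copies — is CURED in v3: the ★ sequel `Theorems/HCCMUnconditionalHLiu418OfCurveTheta.lean` exists and is imported instead.)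
**EDITION v3 «★-ONLY CONE» (LA2-p03 (g9) cand on top of v2 985504774f4a16bf, 2026-09-03; for the LEAD's word).**  Same registered stubs, names and statement tokens as v2 ({`stub_letter_A2P_hodgeFree`} the ONE `sorry`; `stub_S1`, `stub_S1b`, `stub_D9op` paid by term; head `HLiu418_of_d6 (h21) (h413)` unchanged); what moves is the CONE: the by-term payments and the certificate now come from the ★ chain «HLiu418 OF #184♮» — `stub_S1 := HLiu418OfCurveTheta.s1Shape_of_curveTheta_nonOrthogonal₂ ‹letter›`, `stub_S1b := HLiu418OfCurveTheta.s1bShape_of_curveTheta_nonOrthogonal₂ ‹letter›` (★ p853732 over ★ F1 p853696 LD1 θ-road in binder form, ★ F2 p853699 LD2 organ road in binder form, ★ F3 p853706 the `F0_AlbCm` junctions J0 ∕ S1b cut), `thm415AtFace_of_thmD6 := ★ F4 p853722 `A3Liu418Thm415AtFaceOfThmD6.thm415AtFace_of_thmD6`` (the `a3_liu418` v22 face composition with `stub_D6` as the hypothesis) — so the file imports NO `Cruxes/*/Lines` module except the ★ shim `Lines/D6CmCurveBody`: `Lines/a3_liu418` (idle `sorry` `stub_D6` :631) and the two LD leaves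 (idle `sorry`d letter stubs :735 ∕ :665) LEAVE the import closure, whose ONLY `sorry` is now the registered letter; v2's in-file glue §«OfLetter» (6 theorems, J0 at 400 k) and `s34AtFace_of_thmD6` are dropped (their content is ★).  Certificate `HLiu418_of_letter` = this file's `HLiu418_of_d6_stubs` at the ★ letter-terms, and `type_of%`-equal to ★ `HLiu418OfCurveTheta.HLiu418_of_curveTheta_nonOrthogonal₂_of_items` (junction `rfl` in-file).
HC_CM is proved only modulo the 7 printed citations until rung 0 closes. -/

namespace Summit.HodgeConjecture.HodgeConjecture.Cruxes.HLiu418.D6CmCurve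

set_option linter.dupNamespace false  -- `Summit.HodgeConjecture.HodgeConjecture.…` BY DESIGN (D-0017; lakefile sets it for the Summits lib, a loose `lean check` does not)

open Summit.HodgeConjecture.CorCM.Lines.A3Liu418
open Summit.HodgeConjecture.CorCM.HypLiu418

/-! ### EDITION v2∕v3: THE ONE PRINTED LETTER (the ONLY `sorry` of the file); the theta rows `stub_S1` ∕ `stub_S1b` are paid from it by ★ terms (v3: ★ `HLiu418OfCurveTheta`) -/


/-- **LETTER STUB (A₂-P♮) (EDITION 11; ROAD O)** — the HODGE-FREE non-orthogonality letter: BY NAME ★ `Liu2021.curveTheta_nonOrthogonal₂` (LA7-p01 (g7)) = ★ #184 `Liu2021.curveHolTheta_nonOrthogonal₂` (p849575) with the `(𝔣 : ConeFrame …)` binder and the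
`P.IsHolCotangentAt₂ … 𝔣 →` hypothesis DELETED and nothing else (LD-ref1 LETTER AUDIT (n1) 12:30:11Z, BOX ROAD-O #4 (c-i)(c-ii) 13:05:30Z: [Liu2021, Thm. B.4 (1)] is stated for an
arbitrary irreducible admissible `π` with a cuspidal realisation, archimedean-blind; `♮ ⇒ #184` is ★ `curveHolTheta_nonOrthogonal₂_of_hodgeFree`).  A discrete `P` of `U(H)` with the
θ-type finite component `σ` is NOT ORTHOGONAL to the theta lifts from some line `⟨b⟩`.  It REPLACES the two ED. 3–10 letter stubs {`stub_letter_A₂P` (#184), `stub_letter_B6` (#185)}: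
ROAD O (LD1-p01 (g5), orthogonal copy = [Liu2021, proof of Cor. B.6 (3)] run backwards) derives the organ (R) for hol₂ `P` from THIS letter + ★ (I′) + the ★ unitary-class pin, so (B6) is
BYPASSED for hol `P` (never «proved»: the global `ThetaSpaceRealises₂` ∕ (M1θ) stay printed capital, unused).  Shared with the LD2 leaf (K2, ED. 11).
[cite: Liu2021, App. B Thm. B.4 (1) (a)⇒(c) (p. 98); App. D proof of Prop. D.4 (1) (p. 131 L8–21)] [cite: GinzburgJiangSoudry2009, Thm. 1.1]
REGISTERED HERE (EDITION v2 «ONE PRINTED LETTER», «M-152b»; ASCII name for the gate's skeleton reader, registrar A-plan2 (g31) m20) = the LD leaves' `stub_letter_A₂P_hodgeFree`,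
same statement `Literature.NumberTheory.Automorphic.Liu2021.curveTheta_nonOrthogonal₂` (docstring above verbatim from `Lines/F0_P6LD_StubS1FactsThetaRoad.lean` ED. 11 :727–734):
THE ONE `sorry` OF THIS FILE — `stub_S1` ∕ `stub_S1b` are paid by ★ terms from it below (v3: ★ `HLiu418OfCurveTheta.s1Shape_of_curveTheta_nonOrthogonal₂` ∕ `….s1bShape_of_curveTheta_nonOrthogonal₂`), and `HLiu418_of_letter` certifies the crux decl from it + `H21` + `H413` WITHOUT `sorry`. -/
theorem stub_letter_A2P_hodgeFree : Literature.NumberTheory.Automorphic.Liu2021.curveTheta_nonOrthogonal₂ := by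
  sorry


/-! ### Registered stubs (EDITION v2∕v3: all three PAID BY TERM — registered names and statement tokens unchanged; every other input is a ★ theorem BY NAME) -/

/-- **REGISTERED STUB `stub_S1 : S1Shape`** — ORIENTATION-NEUTRAL (REF1 m41 (A)∕m42, ref2 (g12) l09, A-p15 (g12) memo `HodgeAxisSignBox` 9eed785340d1ab8a = 24832 evidence #57:
the rank bound reads identically on `X⋆` and on `M⋆`, ★ `rank_omegaHom_GS_eq_GSM` p764057; the 🟧 marker that sat here until v1 now sits on `stub_S1b`) —
S1 clause (1) = [Liu2021, Prop. D.4 (1)] «multiplicity at most one» at the registered `ω⋆_lab`: any two elements of `Hom(ι′ ∘ ω⋆_lab, ℚ̄_ℓ ⊗ H¹_ét(A_∞))`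
are `ℚ̄_ℓ`-proportional.  WHY PLAUSIBLE: theta-correspondence multiplicity one for `U(1,1) × U(1)` (Rogawski) read on the Albanese tower; size XL.
**PROVED BY ★ TERM over the ONE printed letter** (EDITION v3; v2 «M-152b» paid it by the in-file `s1Shape_of_letter`): `:= HLiu418OfCurveTheta.s1Shape_of_curveTheta_nonOrthogonal₂ stub_letter_A2P_hodgeFree`
(★ p853732 over ★ F1 `F0P6LD1StubS1FactsOfA2P` = LD1 θ-road head #73 in binder form, ★ F2 `F0P6LD2StubS1bFactsOfA2P` = LD2 head #74R in binder form, ★ F3 `F0AlbCmThetaRowsOfFacts` =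
★ `F0AlbCmS1BettiHoldsSignedThetaNecPos` ∕ `F0AlbCmStubS1Pinning` + junction J0); registered name and statement tokens unchanged.
[cite: Liu2021, Prop. D.4 (1) p. 130; Rem. D.5 p. 131 (l. 5396–5405); §D.3 l. 5353–5359] [cite: Rogawski1990, §13.3] -/
theorem stub_S1 : S1Shape :=
  HLiu418OfCurveTheta.s1Shape_of_curveTheta_nonOrthogonal₂ stub_letter_A2P_hodgeFree

/-- **REGISTERED STUB `stub_S1b : S1bShape`** 🟧 AMBER (director hodgecm-mathlib s201: «F-orient ≡ S1-parity» — the orientation content of the line sits HERE: Case A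
«Hodge type `(1,0)` iff `ι₁ ∈ Φ_μ`» is print's [Rem. D.5] EXACT under the cell's reading WORLD C (print's curve = `M⋆`; the complex fibre of the GS tower `X⋆ = M ⊗_{F,c} F` at `ι₁`
is the CONJUGATE of `M⋆`'s, Hodge types swap) and MIRRORED under De79-literal — the SAME one bit as `stub_D6` ∕ `HypLiu418`, not an independent sign; REF1 (g11) m42,
ref2 (g12) l09, `referees/RULING-F-orient-S1parity-ref1g11.md` §4) — S1 clause (2) [Liu2021, Prop. D.4 (1) ∕ Rem. D.5] on the CM quotient, INTRINSIC phrasing (REF1 m06 (R7)): for the S2′ data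
and every CM-type realisation of the quotient at `ι₁`, some non-zero `τ`-eigenvector of `H¹(B′ ×_{F,ι₁} ℂ; ℂ)` has Hodge type `(1,0)` iff `ι₁ ∈ Φ_μ`.
WHY PLAUSIBLE: print's `m_cusp(π_∞^{(1,0)} ⊗ π^∞) = 1 iff ε is μ-admissible`; size L–XL.
**PROVED BY ★ TERM over the ONE printed letter** (EDITION v3; v2 «M-152b» paid it by the in-file `s1bShape_of_letter`): `:= HLiu418OfCurveTheta.s1bShape_of_curveTheta_nonOrthogonal₂ stub_letter_A2P_hodgeFree`
(★ p853732 over ★ F2 `F0P6LD2StubS1bFactsOfA2P` = LD2 organ-road head #74R in binder form, ★ F3 = ★ `F0AlbCmS1bHodgeHoldsNecPos` ∕ `F0AlbCmStubS1Pinning` ∕ `F0P5StubS1bTransfer`);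
registered name and statement tokens unchanged.
[cite: Liu2021, Prop. D.4 (1) p. 130; Rem. D.5 p. 131; Thm. D.6 (1) p. 132 (l. 5433–5443)] -/
theorem stub_S1b : S1bShape :=
  HLiu418OfCurveTheta.s1bShape_of_curveTheta_nonOrthogonal₂ stub_letter_A2P_hodgeFree

/-! S2′ input (i) `IrrOrZeroOmegaStarShape` ([Liu2021, Def. 4.11 + Lem. D.1 (1)] «irreducible or zero») is the THEOREM `irrOrZeroOmegaStarShape_holds`
(namespace `Summit.HodgeConjecture.CorCM.Lines.A3Liu418`, A-p11 (g12) v11 Part M above) over BARE CorCM ★ p759294 `isIrreducibleOrZero_omegaStarGS` (A-p13 (g19) chain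
★ p758072 (A) · p758444 (B1) · p758797 (B2) · p759294 (C)); the former registered stub `stub_IrrOrZeroOmegaStar` is STRUCK (A-plan2 (g12) 03:41:57Z). -/


/-- **`RosHShape` IS A THEOREM OUTRIGHT** (vB8 = vB6 with BOTH §8.2 Jacobian rows DISCHARGED by import of their ★ closers: VI-7 (F-R)
`Literature.AlgebraicGeometry.Motives.Jacobian.riemann_brillNoetherLocus_isPrincipalPolarizationDivisor_holds` (G5) and VI-8 (F-P2)
`Literature.AlgebraicGeometry.Motives.Jacobian.galoisCover_pullback_isWeilPairingAdjoint_norm_holds` (G4); director s223 (2)/s233 (2)/09:45:54Z, vB6: the former registered stub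
`stub_RosH : RosHShape := sorry` is REPLACED by this theorem, proved BY IMPORT of ★ p765203 `CorCM/HypLiu418/A3Liu418GSRosH` — A-p02 (g14) head
`Summit.HodgeConjecture.CorCM.Lines.A3Liu418.socketRosH_GS_of_FR_FP2 S hU7ₛ hLQ h4 isoₛ hFR hFP2` over ★ p764986 `A3Liu418GSRosHLetters` (A-p18 (g12)) and ★ p764022;
no paste of its body).  The ROSATI input of S2′ ON THE HECKE IMAGE ONLY: for every small level `K`, a POSITIVE ANTI-INVOLUTION `τ` of the `ℚ`-algebra
`H_K := T.heckeImage hD K ⊆ End⁰(A_K)` (`Literature.RingTheory.CentralSimple.IsPositiveAntiInvolution`); it gives `IsSemisimpleRing H_K` (Milne CM 1.36), `SocketRosZ`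
(★ p757326) and the block-field positivity (★ p757337), so the σ-free road (P) composition consumes it in FULL.  The two classical inputs of ★ p765203, the §8.2 decls
`Literature.AlgebraicGeometry.Motives.Jacobian.riemann_brillNoetherLocus_isPrincipalPolarizationDivisor` (VI-7, Riemann: `W_{g-1}` is a principal polarization divisor) and
`Literature.AlgebraicGeometry.Motives.Jacobian.galoisCover_pullback_isWeilPairingAdjoint_norm` (VI-8, pull-back/norm adjointness under a Galois cover), are supplied here by
their ★ THEOREMS `…_holds` (no binders): nothing printed is threaded to the heads `s2primeShape_holds`, `thmD6_of_d6`, `HLiu418_of_d6` below.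
[cite: Liu2021, App. D §D.4 p. 140; §4.2] [cite: MumfordAV1970, §21 Thm. 1 p. 208] [cite: LangeRodriguez2022, §3.2.1 Prop. 3.2.1 p. 55] -/
theorem rosH_holds : RosHShape :=
  fun _F _ _ι₁ _μ _hμ _hw _ℓ _ _ι' _Jstar _t _ht _hτt _hτt' _gstar _dJ _hdJ _hdJ0 _hg _hsig _K₀ S hU7ₛ hLQ h4 isoₛ _r _ε _hadm _χ =>
    socketRosH_GS_of_FR_FP2 S hU7ₛ hLQ h4 isoₛ
      Literature.AlgebraicGeometry.Motives.Jacobian.riemann_brillNoetherLocus_isPrincipalPolarizationDivisor_holds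
      Literature.AlgebraicGeometry.Motives.Jacobian.galoisCover_pullback_isWeilPairingAdjoint_norm_holds

/-! (MO) input `MultOneShapePH` ([Liu2021, Lem. D.3 + Prop. D.4 (1)] feeding (D.5): at every registered binder tuple `SocketRosH T hD → (ρW⋆).IsIrreducible →
SocketMultOne ℓ X ι′ ρW⋆ T hD`) is the THEOREM `multOneShapePH_holds` (namespace `Summit.HodgeConjecture.CorCM.Lines.A3Liu418`, A-p11 (g12) v12 Part O above) over ★ (F3)
`Literature.NumberTheory.Automorphic.Liu2021.AppendixC.Sec42Data.HeckeTranslates.exists_block_multOne` (A-p07 (g12) three-file split ★ p760892 · p761036 · (3), with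
A-p05 (g12)) via `socketMultOne_of_hss`; the B‴ stub `stub_MultOne` is STRUCK (A-p11 (g12) 04:33:40Z; director s214 (3)). -/

/-- `S2primeShape` ([Liu2021, App. D §D.4] isotypic-quotient CM structure), σ-FREE road (P): A-p11 (g12) v10 Part K′
`s2primeShape_of_RosH_S1 hRosH hS1` = `s2primeShape_of_stubShapesM1H irrOrZeroOmegaStarShape_holds hRosH multOneShapePH_holds hS1` (v12: `SocketKw` by ★ p757315, `IsSemisimpleRing H_K`/`hssM`
from `SocketRosH`, (4′) socket by A-p09 (g14)՚s levelwise chain ★ (VI′)/(VIII′)/(B′) + ★ p758618, `σ := 1 ⊗ rhoEt` constructed, `SocketMultOne` from ★ (F3), multiplicity one from `stub_S1`)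
applied to `rosH_holds` (vB8: `RosHShape` by import of ★ p765203, rows VI-7/VI-8 by their ★ closers) and the stub `stub_S1`. -/
theorem s2primeShape_holds : S2primeShape :=
  s2primeShape_of_RosH_S1 rosH_holds stub_S1

/-- **REGISTERED STUB `stub_D9op : CorD9OnMOp CMgsm XMgsm`** — [Liu2021, Cor. D.9] (l. 5579–5585) Eichler–Shimura relation for the untwisted tower `M⋆`,
OPERATOR-LEVEL on `ℚ̄_ℓ ⊗ H¹_ét(A(M⋆)_∞)` (arithmetic-Frobenius form `N(w) • Φ_σ² ∘ T_{w,2} − Φ_σ ∘ T_{w,1} + 1 = 0` on `K`-fixed classes).  A PRINTED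
result: director s201 (3)(i) ∕ s205–s206 file it next run as the Literature schema `Liu2021/CorD9OnRecordCurve.lean :: CorD9OnMOp` + instance (then this
stub closes by `Iff.rfl` ∕ by name); until then it is the line's fourth registered input.  Size L (port of [Liu2021, §D.4 proof of Cor. D.9] over ★ `HeckeEndomorphism`).
**PROVED BY ★ TERM (K6, p853642; MOD boundary CLOSED-DERIVED IN-HOUSE)** — ED. v1∕v2 («M-152»): the body is the ★ theorem
`Summit.HodgeConjecture.HodgeConjecture.Cruxes.HLiu418.F0D9opRoad2.stub_D9op_holds : CorD9OnMOp CMgsm XMgsm` (`Theorems/F0D9opRoad2.lean`, sorry-free, axioms TRIO),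
the same FQN the socket `Lines/F0_AlbCm.lean` pays `stub_D9op` with; registered name and statement tokens unchanged (junction `example` below).
[cite: Liu2021, Cor. D.9 p. 138 (l. 5579–5585); Prop. D.8 p. 135] [cite: Carayol1986Compositio, §10.3 p. 210] -/
theorem stub_D9op : CorD9OnMOp CMgsm XMgsm :=
  Summit.HodgeConjecture.HodgeConjecture.Cruxes.HLiu418.F0D9opRoad2.stub_D9op_holds

-- JUNCTION CERTIFICATE («M-152» (c)): the registered stub and the ★ term have the same type, token for token.
example : type_of% @stub_D9op = type_of% @Summit.HodgeConjecture.HodgeConjecture.Cruxes.HLiu418.F0D9opRoad2.stub_D9op_holds := rfl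

/-! ### Composition to the crux decl BY NAME (kernel-checked; no `sorry` below this line) -/

/-- `thmD6OneCurveCUF` ([Liu2021, Thm. D.6 (1)] for the one curve, the registry's `stub_D6` statement) from the THREE registered stubs `stub_S1`, `stub_S1b`,
`stub_D9op` ALONE (vB8: rows VI-7/VI-8 by their ★ closers inside `s2primeShape_holds`) — A-p15 (g11) v22 head. -/
theorem thmD6_of_d6 : thmD6OneCurveCUF :=
  thmD6OneCurveCUF_of_D9Mop stub_S1 stub_S1b s2primeShape_holds stub_D9op

/-- [Liu2021, Thm 4.15] pinned at the face from a `thmD6OneCurveCUF` binder and the route item `H413` — EDITION v3: the ★ term F4 `A3Liu418Thm415AtFaceOfThmD6.thm415AtFace_of_thmD6`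
(LA2-p02 (g7), p853722: the `a3_liu418` v22 face composition `thm415AtFace_of_R0_S` ∘ `thm415FrobeniusAtFace_of_split` — (R0) Frobenius-dense pinning, MULT1 from `H413`, S34 from GS-6 of
[Thm. D.6 (1)], S5 — written over the ★ sources with `stub_D6` as the hypothesis); v2 spelled it through the `Lines/a3_liu418` registry glue and an in-file `s34AtFace_of_thmD6`.
[cite: Liu2021, Thm. 4.15; Prop. 4.13; Thm. D.6 (1) p. 132] -/
theorem thm415AtFace_of_thmD6 (hD6 : thmD6OneCurveCUF)
    (h413 : Summit.HodgeConjecture.HodgeConjecture.Theses.HCCMUnconditional.H413) : Thm415AtFace :=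
  A3Liu418Thm415AtFaceOfThmD6.thm415AtFace_of_thmD6 hD6 h413

/-- **HEAD OF THE LINE — the crux decl BY NAME from the three registered stubs and the route items `H21`, `H413` ONLY (vB8: no printed-fact binder).** -/
theorem HLiu418_of_d6
    (h21 : Summit.HodgeConjecture.HodgeConjecture.Theses.HCCMUnconditional.H21)
    (h413 : Summit.HodgeConjecture.HodgeConjecture.Theses.HCCMUnconditional.H413) :
    Summit.HodgeConjecture.HodgeConjecture.Theses.HCCMUnconditional.HLiu418 :=
  HLiu418_of_h415 (thm415AtFace_of_thmD6 thmD6_of_d6 h413) h21 h413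

/-- THE SOCKET (vB8c: `private`, like `HLiu418_of_d6_shapes` ∕ `HLiu418_of_d6_stubs` below, so that the Lean skeleton audit `#h21_check_skeleton` — which enumerates the theorems concluding the crux decl in ENVIRONMENT order, not file order, and takes the first — sees the head `HLiu418_of_d6` (binders = route items `H21`, `H413` only) as the ONLY public theorem concluding `…HCCMUnconditional.HLiu418`): `HCCMUnconditional.HLiu418` from a `thmD6OneCurveCUF` binder + items `H21`, `H413` (★ `HLiu418_of_h415`; HD3 = ★ `HD3_proof` inside). -/
private theorem HLiu418_of_thmD6 (hD6 : thmD6OneCurveCUF)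
    (h21 : Summit.HodgeConjecture.HodgeConjecture.Theses.HCCMUnconditional.H21)
    (h413 : Summit.HodgeConjecture.HodgeConjecture.Theses.HCCMUnconditional.H413) :
    Summit.HodgeConjecture.HodgeConjecture.Theses.HCCMUnconditional.HLiu418 :=
  HLiu418_of_h415 (thm415AtFace_of_thmD6 hD6 h413) h21 h413

/-- The same composition with the stub STATEMENTS as hypotheses (CRUX-PLAN (A) shape `stub-sigs → … → CruxDecl`; no `sorry` in its closure). -/
private theorem HLiu418_of_d6_shapes (h1 : S1Shape) (h1b : S1bShape) (hIrr : IrrOrZeroOmegaStarShape) (hRosH : RosHShape) (hM : MultOneShapePH)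
    (hD9op : CorD9OnMOp CMgsm XMgsm)
    (h21 : Summit.HodgeConjecture.HodgeConjecture.Theses.HCCMUnconditional.H21)
    (h413 : Summit.HodgeConjecture.HodgeConjecture.Theses.HCCMUnconditional.H413) :
    Summit.HodgeConjecture.HodgeConjecture.Theses.HCCMUnconditional.HLiu418 :=
  HLiu418_of_thmD6 (thmD6OneCurveCUF_of_D9Mop h1 h1b (s2primeShape_of_stubShapesM1H hIrr hRosH hM h1) hD9op) h21 h413

/-- … and with inputs (i) and (MO) discharged by the ★-backed theorems: the crux decl from EXACTLY the three registered stub statements, a `RosHShape` hypothesis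
(discharged in `HLiu418_of_d6` by the theorem `rosH_holds`) + `H21`, `H413`. -/
private theorem HLiu418_of_d6_stubs (h1 : S1Shape) (h1b : S1bShape) (hRosH : RosHShape) (hD9op : CorD9OnMOp CMgsm XMgsm)
    (h21 : Summit.HodgeConjecture.HodgeConjecture.Theses.HCCMUnconditional.H21)
    (h413 : Summit.HodgeConjecture.HodgeConjecture.Theses.HCCMUnconditional.H413) :
    Summit.HodgeConjecture.HodgeConjecture.Theses.HCCMUnconditional.HLiu418 :=
  HLiu418_of_d6_shapes h1 h1b irrOrZeroOmegaStarShape_holds hRosH multOneShapePH_holds hD9op h21 h413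

/-- **CERTIFICATE (EDITION v2∕v3; `private`, `#h21_check_skeleton` discipline): the crux decl from the ONE printed letter #184♮ + the route items `H21`, `H413`** —
the file's composition with the letter as a BINDER instead of the registered `sorry`; kernel-checked with axioms {propext, Classical.choice, Quot.sound} (no `sorryAx`).
[cite: Liu2021, Thm. 4.18; Thm. D.6 (1) p. 132; Prop. D.4 (1) p. 130; Rem. D.5 p. 131; Cor. D.9 p. 138; App. B Thm. B.4 (1) p. 98] -/
private theorem HLiu418_of_letter (h184 : Literature.NumberTheory.Automorphic.Liu2021.curveTheta_nonOrthogonal₂)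
    (h21 : Summit.HodgeConjecture.HodgeConjecture.Theses.HCCMUnconditional.H21)
    (h413 : Summit.HodgeConjecture.HodgeConjecture.Theses.HCCMUnconditional.H413) :
    Summit.HodgeConjecture.HodgeConjecture.Theses.HCCMUnconditional.HLiu418 :=
  HLiu418_of_d6_stubs (HLiu418OfCurveTheta.s1Shape_of_curveTheta_nonOrthogonal₂ h184) (HLiu418OfCurveTheta.s1bShape_of_curveTheta_nonOrthogonal₂ h184)
    rosH_holds stub_D9op h21 h413

-- JUNCTION CERTIFICATE (EDITION v3): the in-file certificate and the ★ Theorems-side closer `HLiu418OfCurveTheta.HLiu418_of_curveTheta_nonOrthogonal₂_of_items` (p853732) have the same type.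
example : type_of% @HLiu418_of_letter = type_of% @HLiu418OfCurveTheta.HLiu418_of_curveTheta_nonOrthogonal₂_of_items := rfl

end Summit.HodgeConjecture.HodgeConjecture.Cruxes.HLiu418.D6CmCurve
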